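import Summits.KontsevichZagierPeriods.KontsevichZagierPeriods.Theses.LiftingCriteria
import Literature.ModelTheory.ExponentialFields.SemialgebraicInterior

/-!
# Route LiftingCriteria — `VertexGlue` (stmt-KontsevichZagierPeriods-3576)

Glue of the unconditional rung of route LiftingCriteria (problem `KontsevichZagierPeriods`):
`VertexLocalLift → DilationTransfer → VertexKernel`.

Given regular rational integrands `pᵢ/qᵢ ∈ ℚ(z)` on an open `U ⊇ [0,1]ⁿ`, `VertexLocalLift` supplies
`b₀`; we use `max b₀ 1` (so that `ϖ₀ = 1/b ∈ (0,1]`). For `b ≥ max b₀ 1` and a vanishing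
`ℤ`-combination `m₀·[1] + Σ mᵢ·[rᵢ]` of the unit representation and cube representations of the fibres
`z ↦ pᵢ(z/b)/qᵢ(z/b)`:

* bookkeeping: `KZ.eval` of the combination is `m₀ + Σ mᵢ v_{pᵢ/qᵢ}(1/b)` (the unit representation has
  value `1`, `Fin 0 → ℝ` being a point of volume `1`; the cube representations have the dilation
  values), so `VertexLocalLift` lifts the numerical relation to a functional one
  `w(ϖ) = (ϖ − 1/b)(μ₀ + Σ μⱼ v_{Gⱼ})` on `[0,1]`;
* Nash data: `U` is shrunk to a RATIONAL open box `V = (−δ, 1+δ)ⁿ ⊆ U` (`δ ∈ ℚ`, compactness of the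
  cube), which is `ℚ`-semialgebraic, so that `pᵢ/qᵢ` is a `ℚ`-semialgebraic (`qᵢ ≠ 0` on `V`) and
  real-analytic function on `V`;
* `DilationTransfer` at the rational point `ϖ₀ = (b : ℚ)⁻¹` (casts `((b:ℚ)⁻¹ : ℝ) = (b:ℝ)⁻¹`) turns the
  functional relation into membership of the combination in `KZ.relations`.

Pure proof file; no definitions, no named facts. Source: the route file (items 3573, 3572, 3575);
M. Kontsevich, D. Zagier, *Periods* (2001), §1.2.
-/

noncomputable section

open MeasureTheory Set MvPolynomial
open Literature.NumberTheory.Transcendental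
open Literature.ModelTheory.ExponentialFields (IsSemialgebraic analyticOnNhd_aeval
  isSemialgebraic_setOf_eval_lt)

namespace Summit.KontsevichZagierPeriods.LiftingCriteria

/-- The rational open box `(a, c)ⁿ ⊆ ℝⁿ` (`a c ∈ ℚ`) is `ℚ`-semialgebraic: it is cut out by the `2n`
strict inequalities `a < zⱼ`, `zⱼ < c` with rational coefficients. [folklore] -/
theorem isSemialgebraic_pi_Ioo_ratCast (nn : ℕ) (a c : ℚ) :
    IsSemialgebraic ℚ (Set.pi Set.univ (fun _ : Fin nn => Set.Ioo (a : ℝ) (c : ℝ))) := by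
  have h : (Set.pi Set.univ (fun _ : Fin nn => Set.Ioo (a : ℝ) (c : ℝ))) =
      ⋂ j ∈ (Finset.univ : Finset (Fin nn)),
        ({x : Fin nn → ℝ | aeval x (C a : MvPolynomial (Fin nn) ℚ) <
            aeval x (X j : MvPolynomial (Fin nn) ℚ)} ∩
          {x : Fin nn → ℝ | aeval x (X j : MvPolynomial (Fin nn) ℚ) <
            aeval x (C c : MvPolynomial (Fin nn) ℚ)}) := by
    ext x
    simp [Set.mem_pi]
  rw [h]
  exact IsSemialgebraic.biInter _ _ fun j _ =>
    (isSemialgebraic_setOf_eval_lt _ _).inter (isSemialgebraic_setOf_eval_lt _ _)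

/-- Shrinking an open neighbourhood of the closed unit cube to a rational open box: if `U ⊆ ℝⁿ` is
open and contains `[0,1]ⁿ`, then `(−δ, 1+δ)ⁿ ⊆ U` for some rational `δ > 0` (compactness of the cube
in the sup metric). [folklore] -/
theorem exists_rat_pi_Ioo_subset {nn : ℕ} {U : Set (Fin nn → ℝ)} (hU : IsOpen U)
    (hcube : Set.pi Set.univ (fun _ : Fin nn => Set.Icc (0:ℝ) 1) ⊆ U) :
    ∃ δ : ℚ, 0 < δ ∧ Set.pi Set.univ (fun _ : Fin nn => Set.Ioo (-(δ : ℝ)) (1 + δ)) ⊆ U := by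
  obtain ⟨ε, hε, hεU⟩ :=
    (isCompact_univ_pi fun _ : Fin nn => isCompact_Icc).exists_thickening_subset_open hU hcube
  obtain ⟨δ, hδ0, hδε⟩ := exists_rat_btwn hε
  have hδ0' : (0 : ℚ) < δ := by exact_mod_cast hδ0
  refine ⟨δ, hδ0', fun x hx => hεU ?_⟩
  rw [Metric.mem_thickening_iff]
  refine ⟨fun i => max 0 (min 1 (x i)),
    fun i _ => ⟨le_max_left _ _, max_le zero_le_one (min_le_left _ _)⟩, ?_⟩
  rw [dist_pi_lt_iff hε]
  intro i
  have hxi : x i ∈ Set.Ioo (-(δ : ℝ)) (1 + δ) := hx i (Set.mem_univ i)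
  rw [Real.dist_eq]
  rcases le_total (x i) 0 with h | h
  · rw [min_eq_right (h.trans zero_le_one), max_eq_left h, abs_lt]
    constructor <;> linarith [hxi.1]
  · rcases le_total (x i) 1 with h' | h'
    · rw [min_eq_right h', max_eq_right h, sub_self, abs_zero]
      exact hε
    · rw [min_eq_left h', max_eq_right (zero_le_one : (0:ℝ) ≤ 1), abs_lt]
      constructor <;> linarith [hxi.2]

/-- A quotient `p/q` of rational-coefficient polynomials is real-analytic at every point where the
denominator does not vanish. [folklore] -/
theorem analyticOnNhd_aeval_div_aeval {nn : ℕ} (p q : MvPolynomial (Fin nn) ℚ)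
    {V : Set (Fin nn → ℝ)} (hq : ∀ z ∈ V, aeval z q ≠ 0) :
    AnalyticOnNhd ℝ (fun z : Fin nn → ℝ => aeval z p / aeval z q) V := fun x hx =>
  ((analyticOnNhd_aeval p) x (Set.mem_univ _)).div ((analyticOnNhd_aeval q) x (Set.mem_univ _))
    (hq x hx)

/-- The unit representation (domain all of `Fin 0 → ℝ`, integrand `1`) has value `1`: the space
`Fin 0 → ℝ` is a single point of Lebesgue volume `1`. [folklore] -/
theorem value_eq_one_of_unit (u : KZ.IntegralRep 0) (hu1 : u.domain = Set.univ)
    (hu2 : ∀ x, u.integrand x = 1) : u.value = 1 := by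
  have hvol : volume (Set.univ : Set (Fin 0 → ℝ)) = 1 := by
    rw [volume_pi, Measure.pi_univ]; simp
  rw [KZ.IntegralRep.value, hu1, setIntegral_congr_fun MeasurableSet.univ (fun x _ => hu2 x),
    setIntegral_const]
  simp [Measure.real, hvol]

/-- **`VertexGlue`** (item stmt-KontsevichZagierPeriods-3576 of route LiftingCriteria):
`VertexLocalLift → DilationTransfer → VertexKernel`. For `b ≥ max b₀ 1` (`b₀` from
`VertexLocalLift`), a vanishing `ℤ`-combination of `[1]` and the cube representations of the fibres
`pᵢ(z/b)/qᵢ(z/b)` evaluates to `w(1/b) = m₀ + Σ mᵢ v_{pᵢ/qᵢ}(1/b) = 0`; the lift gives the functional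
relation `w = (ϖ − 1/b)(μ₀ + Σ μⱼ v_{Gⱼ})` on `[0,1]`, and `DilationTransfer` at the rational point
`ϖ₀ = 1/b ∈ (0,1]` — applied to the family `gᵢ = pᵢ/qᵢ`, Nash on a rational open box
`(−δ,1+δ)ⁿ ⊆ U` — puts the combination in `KZ.relations`. [folklore] -/
theorem vertexGlue_proof :
    Summit.KontsevichZagierPeriods.KontsevichZagierPeriods.Theses.LiftingCriteria.VertexGlue := by
  unfold Summit.KontsevichZagierPeriods.KontsevichZagierPeriods.Theses.LiftingCriteria.VertexGlue
  intro hLift hTrans nn S p q U hU hcubeU hq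
  obtain ⟨b₀, hb₀⟩ := hLift nn S p q U hU hcubeU hq
  refine ⟨max b₀ 1, fun b hb m m₀ r u hr hu1 hu2 heval => ?_⟩
  have hb₀b : b₀ ≤ b := le_of_max_le_left hb
  have hb1 : 1 ≤ b := le_of_max_le_right hb
  -- (1) shrink `U` to a rational open box `V ⊇ [0,1]ⁿ` on which the `q i` do not vanish
  obtain ⟨δ, hδ, hVU⟩ := exists_rat_pi_Ioo_subset hU hcubeU
  have hδ' : (0 : ℝ) < δ := by exact_mod_cast hδ
  set V : Set (Fin nn → ℝ) := Set.pi Set.univ (fun _ : Fin nn => Set.Ioo (-(δ : ℝ)) (1 + δ))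
  have hVopen : IsOpen V := isOpen_set_pi Set.finite_univ fun _ _ => isOpen_Ioo
  have hcubeV : Set.pi Set.univ (fun _ : Fin nn => Set.Icc (0:ℝ) 1) ⊆ V :=
    Set.pi_mono fun _ _ => Set.Icc_subset_Ioo (by linarith) (by linarith)
  have hVsa : IsSemialgebraic ℚ V := by
    have h := isSemialgebraic_pi_Ioo_ratCast nn (-δ) (1 + δ)
    push_cast at h
    exact h
  have hqV : ∀ i, ∀ z ∈ V, aeval z (q i) ≠ 0 := fun i z hz => hq i z (hVU hz)
  -- the Nash family `g i = p i / q i` on `V`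
  have hg : ∀ i : Fin S, IsOpen V ∧ Set.pi Set.univ (fun _ : Fin nn => Set.Icc (0:ℝ) 1) ⊆ V ∧
      IsSemialgebraicFunOn ℚ V (fun z : Fin nn → ℝ => aeval z (p i) / aeval z (q i)) ∧
      AnalyticOnNhd ℝ (fun z : Fin nn → ℝ => aeval z (p i) / aeval z (q i)) V :=
    fun i => ⟨hVopen, hcubeV, isSemialgebraicFunOn_aeval_div_aeval hVsa (p i) (q i) (hqV i),
      analyticOnNhd_aeval_div_aeval (p i) (q i) (hqV i)⟩
  -- (2) bookkeeping: `eval` of the combination is `w(1/b) = m₀ + Σ mᵢ v_{pᵢ/qᵢ}(1/b)`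
  have hmeas : MeasurableSet (Set.pi Set.univ (fun _ : Fin nn => Set.Icc (0:ℝ) 1)) :=
    MeasurableSet.univ_pi fun _ => measurableSet_Icc
  have hrval : ∀ i, (r i).value = ∫ z in Set.pi Set.univ (fun _ : Fin nn => Set.Icc (0:ℝ) 1),
      aeval (((b : ℝ)⁻¹) • z) (p i) / aeval (((b : ℝ)⁻¹) • z) (q i) := by
    intro i
    rw [KZ.IntegralRep.value, (hr i).1]
    exact setIntegral_congr_fun hmeas (hr i).2
  have huval : u.value = 1 := value_eq_one_of_unit u hu1 hu2
  have hnum : (m₀ : ℝ) + ∑ i, (m i : ℝ) *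
      (∫ z in Set.pi Set.univ (fun _ : Fin nn => Set.Icc (0:ℝ) 1),
        (fun z : Fin nn → ℝ => aeval z (p i) / aeval z (q i)) (((b : ℝ)⁻¹) • z)) = 0 := by
    have h := heval
    simp only [map_add, map_sum, map_zsmul, KZ.eval_of, zsmul_eq_mul, huval, hrval, mul_one] at h
    exact h
  -- (3) lift the numerical relation at `ϖ₀ = 1/b` to a functional one (VertexLocalLift)
  obtain ⟨T, d, G, W, μ, μ₀, hG, hμ, hμ₀, hfun⟩ := hb₀ b hb₀b m m₀ hnum
  -- (4) transfer at the rational point `ϖ₀ = (b : ℚ)⁻¹ ∈ (0,1]` (DilationTransfer)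
  have hbq : (1 : ℚ) ≤ b := by exact_mod_cast hb1
  have hϖpos : (0 : ℚ) < (b : ℚ)⁻¹ := inv_pos.mpr (lt_of_lt_of_le one_pos hbq)
  have hϖle : (b : ℚ)⁻¹ ≤ 1 := inv_le_one_of_one_le₀ hbq
  have hcast : (((b : ℚ)⁻¹ : ℚ) : ℝ) = (b : ℝ)⁻¹ := by push_cast; rfl
  exact hTrans S (fun _ => nn) (fun i z => aeval z (p i) / aeval z (q i)) (fun _ => V) hg m m₀
    ((b : ℚ)⁻¹) hϖpos hϖle
    ⟨T, d, G, W, μ, μ₀, hG, hμ, hμ₀, fun ϖ hϖ => by rw [hcast]; exact hfun ϖ hϖ⟩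
    r u (fun i => ⟨(hr i).1, fun z hz => by rw [hcast]; exact (hr i).2 z hz⟩) hu1 hu2

end Summit.KontsevichZagierPeriods.LiftingCriteria

end
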